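import Literature.NumberTheory.LFunctions.DirichletLZeroCounting
import Literature.NumberTheory.LFunctions.DedekindZetaDiscriminantBound
import Literature.Analysis.SpecialFunctions.DigammaReflection
import Mathlib.NumberTheory.Harmonic.EulerMascheroni
import HarnessLib

/-!
# The main term of `N(T, χ)` at the central point: parity and the sign of the slope

Topic `Literature/NumberTheory/LFunctions`, vocabulary of `DirichletLZeroCounting.lean` (Montgomery–Vaughan
Theorem 14.5: for a primitive `χ` mod `q` of parity `a = κ ∈ {0, 1}`,
`N(T, χ) = (2 θ_κ(T) + T log q)/π + S(T, χ) + S(T, χ̄)` with the `Γ`-phase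
`θ_κ(T) = gammaArgPhase κ T = ∫₀ᵀ Re (Γ_ℝ'/Γ_ℝ)(½ + κ + iu) du`).

Read at `T → 0`, the MAIN TERM `N_sm(T; q, κ) := (2 θ_κ(T) + T log q)/π` has slope
`N_sm'(0; q, κ) = (log q − log π + ψ((½ + κ)/2))/π` (`deriv_zeroCountingMainTerm_zero`), because
`θ_κ'(0) = Re (Γ_ℝ'/Γ_ℝ)(½ + κ) = −½ log π + ½ ψ(¼ + κ/2)` (`hasDerivAt_gammaArgPhase`,
`deriv_gammaArgPhase_zero`).  Gauss's values `ψ(¾) − ψ(¼) = π` (reflection) then give the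
**parity law at the central point**: `N_sm'(0; q, 1) − N_sm'(0; q, 0) = 1` for every `q`
(`deriv_zeroCountingMainTerm_zero_odd_sub_even`) — near `s = ½` an odd character carries exactly one
more zero per unit height in its main term than an even character of the same conductor — and
`ψ(¼) = −γ − π/2 − 3 log 2` gives the **sign**: the even main term is DECREASING at the central point
for every conductor `q ≤ 180` (`deriv_zeroCountingMainTerm_zero_even_neg`; the exact threshold is
`q < π e^{γ + π/2} · 8 ≈ 215`), while the odd one is increasing from `q ≥ 10` on
(`deriv_zeroCountingMainTerm_zero_odd_pos`).  These are statements about the printed main term only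
(no claim about `S(T, χ)` or about any individual zero); they are the identified first-order law behind
the parity asymmetry of the lowest zeros of Dirichlet `L`-functions of small conductor (cell
`rh-explicit`, GRH arm, `EXTREMALS/GRH/zeros-q50`).  Everything is PROVED; no named facts.

## References
* H. L. Montgomery, R. C. Vaughan, *Multiplicative Number Theory I*, CUP 2007, Theorem 14.5 (p. 454)
  and Appendix C (Gauss's digamma values `ψ(¼)`, `ψ(¾)`, C.11–C.12). [MontgomeryVaughan2007]
* C. P. Hughes, Z. Rudnick, *Linear statistics of low-lying zeros of L-functions*, Quart. J. Math. 54
  (2003) 309–333 (the family average of `N(T, χ)` follows the main term: unitary 1-level density);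
  restated in S. J. Miller, R. Takloo-Bighash, *An Invitation to Modern Number Theory*, Thm 18.2.5. [folklore]
-/

open Complex Real MeasureTheory Filter Set intervalIntegral

namespace Literature.NumberTheory.LFunctions

namespace DirichletTheta

open Literature.Analysis.SpecialFunctions.Complex

/-! ### The `Γ`-phase is differentiable, with derivative `Re (Γ_ℝ'/Γ_ℝ)(½ + κ + iT)` -/

/-- The integrand `u ↦ Re (Γ_ℝ'/Γ_ℝ)(½ + κ + iu)` of `θ_κ` is continuous (`Γ_ℝ'/Γ_ℝ` is holomorphic
on `Re s > 0`). [cite: MontgomeryVaughan2007, Theorem 14.5 (proof, p. 455)] -/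
theorem continuous_re_logDeriv_Gammaℝ_line (κ : ℕ) :
    Continuous fun u : ℝ ↦ (logDeriv Gammaℝ (1 / 2 + κ + u * I)).re := by
  refine continuous_iff_continuousAt.2 fun u ↦ ?_
  have h1 : ContinuousAt (fun u : ℝ ↦ (1 / 2 : ℂ) + κ + u * I) u := by fun_prop
  have h2 : ContinuousAt (logDeriv Gammaℝ) ((1 / 2 : ℂ) + κ + u * I) :=
    (analyticAt_logDeriv_Gammaℝ (by simp; positivity)).continuousAt
  exact Complex.continuous_re.continuousAt.comp (h2.comp (f := fun u : ℝ ↦ (1 / 2 : ℂ) + κ + u * I) h1)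

/-- **`θ_κ'(T) = Re (Γ_ℝ'/Γ_ℝ)(½ + κ + iT)`** (fundamental theorem of calculus on the definition of
`gammaArgPhase`). [cite: MontgomeryVaughan2007, Theorem 14.5] -/
theorem hasDerivAt_gammaArgPhase (κ : ℕ) (T : ℝ) :
    HasDerivAt (gammaArgPhase κ) ((logDeriv Gammaℝ (1 / 2 + κ + T * I)).re) T := by
  have hc := continuous_re_logDeriv_Gammaℝ_line κ
  have h := intervalIntegral.integral_hasDerivAt_right (hc.intervalIntegrable 0 T)
    (hc.stronglyMeasurableAtFilter _ _) hc.continuousAt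
  have e : gammaArgPhase κ = fun T ↦ ∫ u in (0 : ℝ)..T, (logDeriv Gammaℝ (1 / 2 + κ + u * I)).re := by
    funext T; rfl
  rw [e]
  exact h

/-- **The slope of the `Γ`-phase at the central point**:
`θ_κ'(0) = −½ log π + ½ ψ((½ + κ)/2)` (`ψ` real on the positive axis). [cite: MontgomeryVaughan2007, Theorem 14.5 with (C.10) (Γ_ℝ'/Γ_ℝ = −½ log π + ½ ψ(s/2))] -/
theorem deriv_gammaArgPhase_zero (κ : ℕ) :
    deriv (gammaArgPhase κ) 0 =
      -Real.log Real.pi / 2 + (digamma ((((1 / 2 + κ : ℝ)) : ℂ) / 2)).re / 2 := by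
  rw [(hasDerivAt_gammaArgPhase κ 0).deriv]
  have e : (1 / 2 : ℂ) + κ + (0 : ℝ) * I = ((1 / 2 + κ : ℝ) : ℂ) := by push_cast; ring
  rw [e, NumberField.re_logDeriv_Gammaℝ_ofReal (by positivity)]

/-- Even case: `θ₀'(0) = −½ log π + ½ ψ(¼)`. [cite: MontgomeryVaughan2007, Theorem 14.5 with (C.11)] -/
theorem deriv_gammaArgPhase_zero_even :
    deriv (gammaArgPhase 0) 0 = -Real.log Real.pi / 2 + (digamma (1 / 4 : ℂ)).re / 2 := by
  rw [deriv_gammaArgPhase_zero]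
  norm_num

/-- Odd case: `θ₁'(0) = −½ log π + ½ ψ(¾)`. [cite: MontgomeryVaughan2007, Theorem 14.5 with (C.12)] -/
theorem deriv_gammaArgPhase_zero_odd :
    deriv (gammaArgPhase 1) 0 = -Real.log Real.pi / 2 + (digamma (3 / 4 : ℂ)).re / 2 := by
  rw [deriv_gammaArgPhase_zero]
  norm_num

/-- **Parity at the central point for the `Γ`-phase**: `θ₁'(0) − θ₀'(0) = π/2` (Gauss:
`ψ(¾) − ψ(¼) = π`). [cite: MontgomeryVaughan2007, Appendix C (C.11)–(C.12)] -/
theorem deriv_gammaArgPhase_zero_odd_sub_even :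
    deriv (gammaArgPhase 1) 0 - deriv (gammaArgPhase 0) 0 = Real.pi / 2 := by
  rw [deriv_gammaArgPhase_zero_odd, deriv_gammaArgPhase_zero_even]
  have h := congrArg Complex.re digamma_three_quarters_sub_digamma_one_quarter
  rw [sub_re, ofReal_re] at h
  linarith

/-! ### The main term `N_sm(T; q, κ) = (2θ_κ(T) + T log q)/π` at `T = 0` -/

/-- The main term of Theorem 14.5 is differentiable with
`N_sm'(T) = (2 Re (Γ_ℝ'/Γ_ℝ)(½ + κ + iT) + log q)/π`. [cite: MontgomeryVaughan2007, Theorem 14.5] -/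
theorem hasDerivAt_zeroCountingMainTerm (κ q : ℕ) (T : ℝ) :
    HasDerivAt (fun T : ℝ ↦ (2 * gammaArgPhase κ T + T * Real.log q) / Real.pi)
      ((2 * (logDeriv Gammaℝ (1 / 2 + κ + T * I)).re + Real.log q) / Real.pi) T := by
  have h1 := (hasDerivAt_gammaArgPhase κ T).const_mul 2
  have h2 : HasDerivAt (fun T : ℝ ↦ T * Real.log q) (Real.log q) T := by
    simpa using (hasDerivAt_id T).mul_const (Real.log q)
  exact (h1.add h2).div_const Real.pi

/-- **The slope of the main term at the central point**:
`N_sm'(0; q, κ) = (log q − log π + ψ((½ + κ)/2))/π`. [cite: MontgomeryVaughan2007, Theorem 14.5 with (C.10)] -/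
theorem deriv_zeroCountingMainTerm_zero (κ q : ℕ) :
    deriv (fun T : ℝ ↦ (2 * gammaArgPhase κ T + T * Real.log q) / Real.pi) 0 =
      (Real.log q - Real.log Real.pi + (digamma ((((1 / 2 + κ : ℝ)) : ℂ) / 2)).re) / Real.pi := by
  rw [(hasDerivAt_zeroCountingMainTerm κ q 0).deriv]
  have e : (1 / 2 : ℂ) + κ + (0 : ℝ) * I = ((1 / 2 + κ : ℝ) : ℂ) := by push_cast; ring
  rw [e, NumberField.re_logDeriv_Gammaℝ_ofReal (by positivity)]
  ring

/-- **PARITY LAW AT THE CENTRAL POINT.** For every conductor `q`, the main term of `N(T, χ)` for an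
ODD character has slope exactly `1` more than for an EVEN character at `T = 0`:
`N_sm'(0; q, 1) − N_sm'(0; q, 0) = (ψ(¾) − ψ(¼))/π = 1`. [cite: MontgomeryVaughan2007, Theorem 14.5 with Appendix C (C.11)–(C.12)] -/
theorem deriv_zeroCountingMainTerm_zero_odd_sub_even (q : ℕ) :
    deriv (fun T : ℝ ↦ (2 * gammaArgPhase 1 T + T * Real.log q) / Real.pi) 0 -
      deriv (fun T : ℝ ↦ (2 * gammaArgPhase 0 T + T * Real.log q) / Real.pi) 0 = 1 := by
  rw [deriv_zeroCountingMainTerm_zero, deriv_zeroCountingMainTerm_zero]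
  have h := congrArg Complex.re digamma_three_quarters_sub_digamma_one_quarter
  rw [sub_re, ofReal_re] at h
  have e1 : ((((1 / 2 + ((1 : ℕ) : ℝ) : ℝ)) : ℂ) / 2) = (3 / 4 : ℂ) := by push_cast; norm_num
  have e0 : ((((1 / 2 + ((0 : ℕ) : ℝ) : ℝ)) : ℂ) / 2) = (1 / 4 : ℂ) := by push_cast; norm_num
  rw [e1, e0]
  have hπ : Real.pi ≠ 0 := Real.pi_ne_zero
  field_simp
  linarith

/-- `Re ψ(¼) = −(γ + π/2 + 3 log 2)` (Gauss). [cite: MontgomeryVaughan2007, Appendix C (C.11)] -/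
theorem re_digamma_one_quarter :
    (digamma (1 / 4 : ℂ)).re = -(Real.eulerMascheroniConstant + Real.pi / 2 + 3 * Real.log 2) := by
  rw [digamma_one_quarter_eq_neg_ofReal, neg_re, ofReal_re]

/-- `Re ψ(¾) = −γ + π/2 − 3 log 2` (Gauss). [cite: MontgomeryVaughan2007, Appendix C (C.12)] -/
theorem re_digamma_three_quarters :
    (digamma (3 / 4 : ℂ)).re = -Real.eulerMascheroniConstant + Real.pi / 2 - 3 * Real.log 2 := by
  have h := congrArg Complex.re digamma_three_quarters_sub_digamma_one_quarter
  rw [sub_re, ofReal_re, re_digamma_one_quarter] at h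
  linarith

/-- **Even characters: the main term DECREASES at the central point for every conductor `q ≤ 180`**
(`N_sm'(0; q, 0) = (log q − log π − γ − π/2 − 3 log 2)/π < 0`; the exact threshold is
`q < 8π e^{γ + π/2} ≈ 215`). [cite: MontgomeryVaughan2007, Theorem 14.5 with Appendix C (C.11)] -/
theorem deriv_zeroCountingMainTerm_zero_even_neg {q : ℕ} (hq1 : 1 ≤ q) (hq : q ≤ 180) :
    deriv (fun T : ℝ ↦ (2 * gammaArgPhase 0 T + T * Real.log q) / Real.pi) 0 < 0 := by
  rw [deriv_zeroCountingMainTerm_zero]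
  have e0 : ((((1 / 2 + ((0 : ℕ) : ℝ) : ℝ)) : ℂ) / 2) = (1 / 4 : ℂ) := by push_cast; norm_num
  rw [e0, re_digamma_one_quarter]
  have hγ := Real.one_half_lt_eulerMascheroniConstant
  have hπ3 : 3.14 < Real.pi := Real.pi_gt_d2
  -- log q ≤ log 180 < log π + 1/2 + π/2 + 3 log 2, via exp: 180 < π · e^{1/2} · e^{π/2} · 8
  have hq' : (q : ℝ) ≤ 180 := by exact_mod_cast hq
  have hqpos : (0 : ℝ) < q := by exact_mod_cast hq1
  have hlogq : Real.log q ≤ Real.log 180 := Real.log_le_log hqpos hq'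
  have hexp_half : (1.64 : ℝ) < Real.exp (1 / 2) := by
    have hl : 1 + (1 / 2 : ℝ) + (1 / 2) ^ 2 / 2 + (1 / 2) ^ 3 / 6 ≤ Real.exp (1 / 2) := by
      have := Real.sum_le_exp_of_nonneg (x := (1 / 2 : ℝ)) (by norm_num) 4
      simpa [Finset.sum_range_succ, Nat.factorial] using this
    linarith
  have hexp_pi : (4.39 : ℝ) < Real.exp (Real.pi / 2) := by
    have hl : 1 + Real.pi / 2 + (Real.pi / 2) ^ 2 / 2 + (Real.pi / 2) ^ 3 / 6 ≤ Real.exp (Real.pi / 2) := by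
      have := Real.sum_le_exp_of_nonneg (x := Real.pi / 2) (by positivity) 4
      simpa [Finset.sum_range_succ, Nat.factorial] using this
    have hp1 : (1.57 : ℝ) < Real.pi / 2 := by linarith
    have hp2 : (1.57 : ℝ) ^ 2 < (Real.pi / 2) ^ 2 := by nlinarith
    have hp3 : (1.57 : ℝ) ^ 3 < (Real.pi / 2) ^ 3 := by nlinarith
    norm_num at hp2 hp3
    linarith
  -- 180 < exp(log π + 1/2 + π/2 + 3 log 2) = π · e^{1/2} · e^{π/2} · 8
  have hkey : Real.log 180 < Real.log Real.pi + 1 / 2 + Real.pi / 2 + 3 * Real.log 2 := by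
    rw [← Real.exp_lt_exp, Real.exp_log (by norm_num : (0 : ℝ) < 180)]
    have e : Real.exp (Real.log Real.pi + 1 / 2 + Real.pi / 2 + 3 * Real.log 2) =
        Real.pi * Real.exp (1 / 2) * Real.exp (Real.pi / 2) * 8 := by
      rw [Real.exp_add, Real.exp_add, Real.exp_add, Real.exp_log Real.pi_pos,
        show (3 : ℝ) * Real.log 2 = Real.log (2 ^ 3) by rw [Real.log_pow]; norm_num,
        Real.exp_log (by norm_num)]
      norm_num
    rw [e]
    have h1 : (3.14 : ℝ) * 1.64 < Real.pi * Real.exp (1 / 2) :=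
      mul_lt_mul'' hπ3 hexp_half (by norm_num) (by norm_num)
    have h2 : (3.14 : ℝ) * 1.64 * 4.39 < Real.pi * Real.exp (1 / 2) * Real.exp (Real.pi / 2) :=
      mul_lt_mul'' h1 hexp_pi (by norm_num) (by norm_num)
    nlinarith
  have hnum : Real.log q - Real.log Real.pi + -(Real.eulerMascheroniConstant + Real.pi / 2 + 3 * Real.log 2) < 0 := by
    linarith
  exact div_neg_of_neg_of_pos hnum Real.pi_pos

/-- **Odd characters: the main term INCREASES at the central point from `q ≥ 11` on**
(`N_sm'(0; q, 1) = (log q − log π − γ + π/2 − 3 log 2)/π > 0`; the exact threshold is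
`q > 8π e^{γ − π/2} ≈ 9.3`, so `q = 10` is also positive, but certifying it needs `γ < 0.65`, sharper
than the tree's `γ < 2/3`). [cite: MontgomeryVaughan2007, Theorem 14.5 with Appendix C (C.12)] -/
theorem deriv_zeroCountingMainTerm_zero_odd_pos {q : ℕ} (hq : 11 ≤ q) :
    0 < deriv (fun T : ℝ ↦ (2 * gammaArgPhase 1 T + T * Real.log q) / Real.pi) 0 := by
  rw [deriv_zeroCountingMainTerm_zero]
  have e1 : ((((1 / 2 + ((1 : ℕ) : ℝ) : ℝ)) : ℂ) / 2) = (3 / 4 : ℂ) := by push_cast; norm_num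
  rw [e1, re_digamma_three_quarters]
  have hγ := Real.eulerMascheroniConstant_lt_two_thirds
  have hq' : (11 : ℝ) ≤ q := by exact_mod_cast hq
  have hlogq : Real.log 11 ≤ Real.log q := Real.log_le_log (by norm_num) hq'
  have hπ4 : Real.pi < 3.1416 := Real.pi_lt_d4
  have hπ4' : 3.1415 < Real.pi := Real.pi_gt_d4
  -- log 11 > log π + 2/3 − π/2 + 3 log 2  ⇔  11 > π · e^{2/3} · e^{−π/2} · 8
  have hkey : Real.log Real.pi + 2 / 3 - Real.pi / 2 + 3 * Real.log 2 < Real.log 11 := by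
    rw [← Real.exp_lt_exp, Real.exp_log (by norm_num : (0 : ℝ) < 11)]
    have e : Real.exp (Real.log Real.pi + 2 / 3 - Real.pi / 2 + 3 * Real.log 2) =
        Real.pi * Real.exp (2 / 3) * Real.exp (-(Real.pi / 2)) * 8 := by
      rw [show Real.log Real.pi + 2 / 3 - Real.pi / 2 + 3 * Real.log 2 =
          Real.log Real.pi + 2 / 3 + -(Real.pi / 2) + 3 * Real.log 2 by ring,
        Real.exp_add, Real.exp_add, Real.exp_add, Real.exp_log Real.pi_pos,
        show (3 : ℝ) * Real.log 2 = Real.log (2 ^ 3) by rw [Real.log_pow]; norm_num,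
        Real.exp_log (by norm_num)]
      norm_num
    rw [e]
    -- e^{2/3} < 1.948 (Taylor with remainder) and e^{−π/2} < 0.21 (e^{π/2} > 4.78, six Taylor terms)
    have hup : Real.exp (2 / 3) < 1.948 := by
      have h := Real.exp_bound' (x := (2 / 3 : ℝ)) (by norm_num) (by norm_num) (n := 5) (by norm_num)
      have hs : (∑ m ∈ Finset.range 5, (2 / 3 : ℝ) ^ m / m.factorial) +
          (2 / 3 : ℝ) ^ 5 * (5 + 1) / (Nat.factorial 5 * 5) < 1.948 := by
        simp [Finset.sum_range_succ, Nat.factorial]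
        norm_num
      exact h.trans_lt hs
    have hdn : Real.exp (-(Real.pi / 2)) < 0.21 := by
      have hl : 1 + Real.pi / 2 + (Real.pi / 2) ^ 2 / 2 + (Real.pi / 2) ^ 3 / 6 + (Real.pi / 2) ^ 4 / 24 +
          (Real.pi / 2) ^ 5 / 120 ≤ Real.exp (Real.pi / 2) := by
        have := Real.sum_le_exp_of_nonneg (x := Real.pi / 2) (by positivity) 6
        simpa [Finset.sum_range_succ, Nat.factorial] using this
      have hp1 : (1.5707 : ℝ) < Real.pi / 2 := by linarith
      have hp2 : (1.5707 : ℝ) ^ 2 < (Real.pi / 2) ^ 2 := by nlinarith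
      have hp3 : (1.5707 : ℝ) ^ 3 < (Real.pi / 2) ^ 3 := by nlinarith
      have hp4 : (1.5707 : ℝ) ^ 4 < (Real.pi / 2) ^ 4 := by nlinarith
      have hp5 : (1.5707 : ℝ) ^ 5 < (Real.pi / 2) ^ 5 := by nlinarith
      norm_num at hp2 hp3 hp4 hp5
      have hpos : (4.78 : ℝ) < Real.exp (Real.pi / 2) := by linarith
      rw [Real.exp_neg]
      calc (Real.exp (Real.pi / 2))⁻¹ < (4.78 : ℝ)⁻¹ := by
            exact inv_strictAnti₀ (by norm_num) hpos
        _ < 0.21 := by norm_num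
    have h1 : Real.pi * Real.exp (2 / 3) < 3.1416 * 1.948 :=
      mul_lt_mul'' hπ4 hup Real.pi_pos.le (Real.exp_pos _).le
    have h2 : Real.pi * Real.exp (2 / 3) * Real.exp (-(Real.pi / 2)) < 3.1416 * 1.948 * 0.21 :=
      mul_lt_mul'' h1 hdn (by positivity) (Real.exp_pos _).le
    nlinarith
  have hnum : 0 < Real.log q - Real.log Real.pi + (-Real.eulerMascheroniConstant + Real.pi / 2 - 3 * Real.log 2) := by
    linarith
  exact div_pos hnum Real.pi_pos

end DirichletTheta

end Literature.NumberTheory.LFunctions
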